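import Mathlib
import Literature.NumberTheory.LFunctions.Zhang2022.Section7cStatements
import Literature.NumberTheory.LFunctions.Zhang2022.Section7cProofs
import Literature.NumberTheory.LFunctions.Zhang2022.Section7cLPolyLargeSieve
import Literature.NumberTheory.LFunctions.Zhang2022.Section5DeltaRapidDecayTail
import HarnessLib

/-!
# Zhang (2022), slice L2-t4: the Mellin and Cauchy steps `§7.u038`–`§7.u041`; (7.15) from the `Δ`-localisation

Topic `Literature/NumberTheory/LFunctions/Zhang2022` (Landau–Siegel audit tree; verdict-neutral).
Companion of `Section7cStatements` (typed claims of Y. Zhang, arXiv:2211.02515v1, §7 pp. 37–39),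
`Section7cProofs` and `Section7cLPolyLargeSieve`. The manuscript's steps (tex L2043–L2058, pp.38–39)

> By the Mellin transform and Lemma 5.4 (i), `𝔰* ≪ 𝓛ᶜ∫|Σ_l (κ∗a₁)(dl)θ(l)l^{−1−it}||Σ_p θ̄(p)p^{1+it+β₃}|dt/(1+t²)`.
> […] It follows by Cauchy's inequality that
> `R^{−3/2} Σ_{R≤r<2R} Σ*_{θ mod r} |𝔰*(R,r,h,d;θ)| ≪ τ₅(d)h𝓛ᶜ(R^{1/2}P^{3/2} + R^{−1/2}P²) ≪ τ₅(d)hP²D^{−c}`.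
> This yields (7.15).

are typed as `Step7u038 c′`, `Step7u041 c′` (two bounds), `Ded715 c′`. This THEOREM-ONLY file proves:

* `step7u041_right` — the second bound of §7.u041, unconditionally, for every exponent `k`, with
  `c = 1/16`, `C = 2·8ᵏ·k!`, `D ≥ 3` (growth arithmetic in the ranges `dh < P₁`, `D ≤ R < (dh)⁻¹P₁`
  of (7.15): `R ≤ P₁ = P^{0.504}`, `R ≥ D`, `𝓛ᵏ ≤ 8ᵏk!·D^{1/8}`, `D^{3/16} ≤ P^{0.248}`);
* `step7u038_hr` — the Mellin step WITH ITS FACTOR `hr`: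
  `|𝔰*| ≤ C𝓛⁵¹⁹⁰·hr·∫|lPoly(1+it)||pPoly(1+it+β₃)|dt/(1+t²)` for all large `D` (exact route: Mellin
  inversion `Δ(x) = (1/2π)∫x^{−(1+it)}δ(1+it)dt`, `Skeleton.DeltaW_eq_mellinInv`, under the finite
  sums; the kernel `(l/(phr))^{−s} = (hr)^{s}l^{−s}p^{s}`; Lemma 5.4 (i) on `σ = 1`,
  `Skeleton.norm_deltaW_line_le`). The printed display omits the factor `hr`
  (`(l/(phr))^{−s}` has modulus `(phr)/l` on `σ = 1`); the next display, §7.u041 with its factor `h`,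
  is exactly what the weighted bound gives — so the printed weightless `Step7u038` is not what the
  Mellin transform delivers, and is not used below except in the edges kept from the first version;
* `first_bound_of_weighted` (private core) — Cauchy's inequality in the pair `(r, θ)` pointwise in `t`
  inside `∫dt/(1+t²)` from a weighted Mellin bound `C₁𝓛^{k₁}(hR)∫…` and the two large-sieve bounds
  (the finite sum and the integral are exchanged; each integrand is continuous and dominated by
  `const/(1+t²)`), `∫dt/(1+t²) = π`, `√((R²+P)P³) ≤ RP^{3/2} + P²`, and
  `R^{−3/2}·R·(RP^{3/2} + P²) = R^{1/2}P^{3/2} + R^{−1/2}P²`;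
* `step7u041_left_of`, `step7u041_of`, `step7u041_of_mellin`, `eq715_of` — the edges from the printed
  `Step7u038` (weight `1 ≤ hR`), kept;
* **`step7u041_holds : Step7u041 c′`** — the Cauchy step HOLDS (weighted Mellin step `hr ≤ 2hR` + the
  tree's `step7u039_holds`, `step7u040_holds`), and hence
  **`eq715_of_truncI : Step7bTruncI c′ → Eq715 c′`** — (7.15) rests on exactly ONE analytic input of
  the block, the `Δ`-localisation `l ∈ 𝔌(Rh)` ("By Lemma 5.1", tex L2036), via the tree's
  `eq715_of_truncI_u041`.

No definitions, no new named facts; nothing is asserted about Theorems 1–2 of the manuscript or about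
Landau–Siegel zeros.

## References

* Y. Zhang, arXiv:2211.02515v1 (2022), §7 pp. 38–39, tex L2043–L2058; §5 Lemma 5.4 (i), (5.14).
  [cite: Zhang2022LandauSiegel, §7 pp.38–39]
-/

noncomputable section

open Complex Real MeasureTheory
open Literature.NumberTheory.LFunctions.Zhang2022

namespace Literature.NumberTheory.LFunctions.Zhang2022.Section7cStatements

/-- `𝓛 ≥ 1` once `D ≥ 3`. [folklore] -/
private theorem one_le_ell {D : ℕ} (hD : 3 ≤ D) : 1 ≤ Skeleton.ell D := by
  have hD' : (3 : ℝ) ≤ D := by exact_mod_cast hD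
  rw [Skeleton.ell, Real.le_log_iff_exp_le (by linarith)]
  exact le_trans (le_of_lt (lt_trans Real.exp_one_lt_d9 (by norm_num))) hD'

/-- The poly-log versus power-saving comparison `𝓛ᵏ ≤ 8ᵏ·k!·e^{𝓛/8}` (from `xᵏ/k! ≤ eˣ`).
[folklore] -/
private theorem ell_pow_le (k : ℕ) {D : ℕ} (hD : 3 ≤ D) :
    Skeleton.ell D ^ k ≤ 8 ^ k * k.factorial * Real.exp (Skeleton.ell D / 8) := by
  have hL : 0 ≤ Skeleton.ell D := zero_le_one.trans (one_le_ell hD)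
  have h := Real.pow_div_factorial_le_exp (Skeleton.ell D / 8) (by positivity) k
  rw [div_pow, div_div, div_le_iff₀ (by positivity)] at h
  calc Skeleton.ell D ^ k ≤ Real.exp (Skeleton.ell D / 8) * (8 ^ k * k.factorial) := h
    _ = 8 ^ k * k.factorial * Real.exp (Skeleton.ell D / 8) := by ring

/-- `Z22:§7.u041`, second bound: `τ₅(d)h𝓛ᵏ(R^{1/2}P^{3/2} + R^{−1/2}P²) ≤ C·τ₅(d)hP²D^{−1/16}` in the
ranges `dh < P₁`, `D ≤ R < (dh)⁻¹P₁` of (7.15), for every `k`, with `C = 2·8ᵏ·k!` and `D ≥ 3`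
(pure growth arithmetic: `R ≤ P₁ = P^{0.504}`, `R ≥ D`, `𝓛ᵏ ≤ 8ᵏk!D^{1/8}`, `D^{3/16} ≤ P^{0.248}`).
[cite: Zhang2022LandauSiegel, §7 p.39, tex L2055] -/
theorem step7u041_right (k : ℕ) : ∃ c : ℝ, 0 < c ∧ ∃ C : ℝ, Skeleton.ForAllLarge fun D _ _ =>
    ∀ (d h : ℕ) (R : ℝ), 0 < d → 0 < h → InRange735 D d h R →
      MeanSquareMajorant.tau 5 d * (h : ℝ) * Skeleton.ell D ^ k *
          (R ^ (1 / 2 : ℝ) * Skeleton.bigP D ^ (3 / 2 : ℝ) +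
            R ^ (-(1 / 2 : ℝ)) * Skeleton.bigP D ^ 2)
        ≤ C * MeanSquareMajorant.tau 5 d * (h : ℝ) * Skeleton.bigP D ^ 2 * (D : ℝ) ^ (-c) := by
  refine ⟨1 / 16, by norm_num, 2 * 8 ^ k * k.factorial, 3, fun D _ χ hD _ _ d h R hd hh hR => ?_⟩
  have hL1 : 1 ≤ Skeleton.ell D := one_le_ell hD
  have hLk : Skeleton.ell D ^ k ≤ 8 ^ k * k.factorial * Real.exp (Skeleton.ell D / 8) :=
    ell_pow_le k hD
  set L := Skeleton.ell D with hLdef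
  set P := Skeleton.bigP D with hPdef
  have hP : 0 < P := Real.exp_pos _
  have hD0 : (0 : ℝ) < D := by exact_mod_cast (show 0 < D by omega)
  have hD1 : (1 : ℝ) ≤ D := by exact_mod_cast (show 1 ≤ D by omega)
  obtain ⟨-, hDR, hRlt⟩ := hR
  have hR0 : 0 < R := hD0.trans_le hDR
  have hdh1 : (1 : ℝ) ≤ ((d * h : ℕ) : ℝ) := by exact_mod_cast Nat.mul_pos hd hh
  have hRP1 : R ≤ Skeleton.P1 D := by
    have hP1 : 0 ≤ Skeleton.P1 D := Real.rpow_nonneg hP.le _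
    exact hRlt.le.trans (div_le_self hP1 hdh1)
  have hlogD : Real.log (D : ℝ) = L := by rw [hLdef, Skeleton.ell]
  have hE : Real.exp (L / 8) = (D : ℝ) ^ (1 / 8 : ℝ) := by
    rw [Real.rpow_def_of_pos hD0, hlogD]; congr 1; ring
  -- the `R^{-1/2}P²` term
  have hX2 : Real.exp (L / 8) * R ^ (-(1 / 2 : ℝ)) ≤ (D : ℝ) ^ (-(1 / 16 : ℝ)) := by
    rw [hE]
    calc (D : ℝ) ^ (1 / 8 : ℝ) * R ^ (-(1 / 2 : ℝ))
        ≤ (D : ℝ) ^ (1 / 8 : ℝ) * (D : ℝ) ^ (-(1 / 2 : ℝ)) :=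
          mul_le_mul_of_nonneg_left
            (Real.rpow_le_rpow_of_nonpos hD0 hDR (by norm_num : -(1 / 2 : ℝ) ≤ 0))
            (Real.rpow_nonneg hD0.le _)
      _ = (D : ℝ) ^ (-(3 / 8) : ℝ) := by rw [← Real.rpow_add hD0]; norm_num
      _ ≤ (D : ℝ) ^ (-(1 / 16 : ℝ)) := Real.rpow_le_rpow_of_exponent_le hD1 (by norm_num)
  -- the `R^{1/2}P^{3/2}` term
  have hX1 : Real.exp (L / 8) * R ^ (1 / 2 : ℝ) * P ^ (3 / 2 : ℝ) ≤
      P ^ 2 * (D : ℝ) ^ (-(1 / 16 : ℝ)) := by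
    have hR12 : R ^ (1 / 2 : ℝ) ≤ P ^ (0.252 : ℝ) := by
      calc R ^ (1 / 2 : ℝ)
          ≤ Skeleton.P1 D ^ (1 / 2 : ℝ) := Real.rpow_le_rpow hR0.le hRP1 (by norm_num)
        _ = P ^ (0.252 : ℝ) := by
          rw [show Skeleton.P1 D = P ^ (0.504 : ℝ) from rfl, ← Real.rpow_mul hP.le]; norm_num
    have hDm : (D : ℝ) ^ (-(1 / 16 : ℝ)) = Real.exp (-(L / 16)) := by
      rw [Real.rpow_def_of_pos hD0, hlogD]; congr 1; ring
    have hP2 : P ^ 2 = P ^ (1.752 : ℝ) * P ^ (0.248 : ℝ) := by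
      rw [← Real.rpow_add hP, ← Real.rpow_two]; norm_num
    have hP248 : P ^ (0.248 : ℝ) = Real.exp (0.248 * L ^ 9) := by
      rw [show P = Real.exp (L ^ 9) from rfl, ← Real.exp_mul]; ring_nf
    have hexp : Real.exp (L / 8) ≤ Real.exp (0.248 * L ^ 9) * Real.exp (-(L / 16)) := by
      rw [← Real.exp_add, Real.exp_le_exp]
      have h9 : L ≤ L ^ 9 := le_self_pow₀ hL1 (by norm_num)
      linarith
    calc Real.exp (L / 8) * R ^ (1 / 2 : ℝ) * P ^ (3 / 2 : ℝ)
        ≤ Real.exp (L / 8) * P ^ (0.252 : ℝ) * P ^ (3 / 2 : ℝ) := by gcongr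
      _ = Real.exp (L / 8) * P ^ (1.752 : ℝ) := by
          rw [mul_assoc, ← Real.rpow_add hP]; norm_num
      _ ≤ (Real.exp (0.248 * L ^ 9) * Real.exp (-(L / 16))) * P ^ (1.752 : ℝ) := by gcongr
      _ = P ^ 2 * (D : ℝ) ^ (-(1 / 16 : ℝ)) := by rw [hP2, hP248, hDm]; ring
  -- assemble
  have hA : L ^ k * (R ^ (1 / 2 : ℝ) * P ^ (3 / 2 : ℝ)) ≤
      8 ^ k * k.factorial * (P ^ 2 * (D : ℝ) ^ (-(1 / 16 : ℝ))) := by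
    calc L ^ k * (R ^ (1 / 2 : ℝ) * P ^ (3 / 2 : ℝ))
        ≤ (8 ^ k * k.factorial * Real.exp (L / 8)) * (R ^ (1 / 2 : ℝ) * P ^ (3 / 2 : ℝ)) := by
          gcongr
      _ = 8 ^ k * k.factorial * (Real.exp (L / 8) * R ^ (1 / 2 : ℝ) * P ^ (3 / 2 : ℝ)) := by ring
      _ ≤ 8 ^ k * k.factorial * (P ^ 2 * (D : ℝ) ^ (-(1 / 16 : ℝ))) := by gcongr
  have hB : L ^ k * (R ^ (-(1 / 2 : ℝ)) * P ^ 2) ≤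
      8 ^ k * k.factorial * (P ^ 2 * (D : ℝ) ^ (-(1 / 16 : ℝ))) := by
    calc L ^ k * (R ^ (-(1 / 2 : ℝ)) * P ^ 2)
        ≤ (8 ^ k * k.factorial * Real.exp (L / 8)) * (R ^ (-(1 / 2 : ℝ)) * P ^ 2) := by gcongr
      _ = 8 ^ k * k.factorial * P ^ 2 * (Real.exp (L / 8) * R ^ (-(1 / 2 : ℝ))) := by ring
      _ ≤ 8 ^ k * k.factorial * P ^ 2 * (D : ℝ) ^ (-(1 / 16 : ℝ)) := by gcongr
      _ = 8 ^ k * k.factorial * (P ^ 2 * (D : ℝ) ^ (-(1 / 16 : ℝ))) := by ring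
  have hmain : L ^ k * (R ^ (1 / 2 : ℝ) * P ^ (3 / 2 : ℝ) + R ^ (-(1 / 2 : ℝ)) * P ^ 2) ≤
      2 * 8 ^ k * k.factorial * P ^ 2 * (D : ℝ) ^ (-(1 / 16 : ℝ)) := by
    calc L ^ k * (R ^ (1 / 2 : ℝ) * P ^ (3 / 2 : ℝ) + R ^ (-(1 / 2 : ℝ)) * P ^ 2)
        = L ^ k * (R ^ (1 / 2 : ℝ) * P ^ (3 / 2 : ℝ)) + L ^ k * (R ^ (-(1 / 2 : ℝ)) * P ^ 2) := by
          ring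
      _ ≤ 8 ^ k * k.factorial * (P ^ 2 * (D : ℝ) ^ (-(1 / 16 : ℝ))) +
          8 ^ k * k.factorial * (P ^ 2 * (D : ℝ) ^ (-(1 / 16 : ℝ))) := add_le_add hA hB
      _ = 2 * 8 ^ k * k.factorial * P ^ 2 * (D : ℝ) ^ (-(1 / 16 : ℝ)) := by ring
  have hτ : 0 ≤ MeanSquareMajorant.tau 5 d := MeanSquareMajorant.tau_nonneg _ _
  have hh0 : (0 : ℝ) ≤ h := Nat.cast_nonneg _
  calc MeanSquareMajorant.tau 5 d * (h : ℝ) * L ^ k *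
        (R ^ (1 / 2 : ℝ) * P ^ (3 / 2 : ℝ) + R ^ (-(1 / 2 : ℝ)) * P ^ 2)
      = (MeanSquareMajorant.tau 5 d * (h : ℝ)) *
          (L ^ k * (R ^ (1 / 2 : ℝ) * P ^ (3 / 2 : ℝ) + R ^ (-(1 / 2 : ℝ)) * P ^ 2)) := by ring
    _ ≤ (MeanSquareMajorant.tau 5 d * (h : ℝ)) *
          (2 * 8 ^ k * k.factorial * P ^ 2 * (D : ℝ) ^ (-(1 / 16 : ℝ))) :=
        mul_le_mul_of_nonneg_left hmain (mul_nonneg hτ hh0)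
    _ = 2 * 8 ^ k * (k.factorial : ℝ) * MeanSquareMajorant.tau 5 d * (h : ℝ) * P ^ 2 *
          (D : ℝ) ^ (-(1 / 16 : ℝ)) := by ring


/-! ### The Cauchy step `§7.u041`: first bound from `§7.u038`–`§7.u040` -/

/-- `Re β₃ = 0`. [cite: Zhang2022LandauSiegel, §2 (2.13)] -/
private theorem beta3_re_eq_zero (c' : ℝ) (D : ℕ) : (Skeleton.beta3 c' D).re = 0 := by
  simp [Skeleton.beta3, Complex.mul_re, Complex.mul_im]

open scoped Classical in
/-- Rewriting the primitive-character double sum `Σ_{R≤r<2R} Σ*_θ` as one sum over a finite set of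
pairs `(r, θ)`. [folklore] -/
private theorem sum_prim_eq_sum_sigma (R : ℝ) (v : (r : ℕ) → DirichletCharacter ℂ r → ℝ) :
    (∑ r ∈ dyadic R, ∑ θ : DirichletCharacter ℂ r, if θ.IsPrimitive then v r θ else 0) =
      ∑ x ∈ (dyadic R).sigma (fun r =>
          (Finset.univ : Finset (DirichletCharacter ℂ r)).filter fun θ => θ.IsPrimitive),
        v x.1 x.2 := by
  rw [Finset.sum_sigma]
  exact Finset.sum_congr rfl fun r _ => (Finset.sum_filter _ _).symm

open scoped Classical in
/-- Members of `𝔌(y) ∩ ℕ` are positive. [folklore] -/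
private theorem pos_of_mem_natI {D : ℕ} {y : ℝ} {l : ℕ} (hl : l ∈ natI D y) : 0 < l :=
  ((Finset.mem_filter.1 hl).2).1

/-- The `l`-polynomial is continuous along the line `s = 1 + it`. [folklore] -/
private theorem continuous_lPoly_line (c' : ℝ) (D : ℕ) (a₁ : ℕ → ℂ) (R : ℝ) (r h d : ℕ)
    (θ : DirichletCharacter ℂ r) :
    Continuous fun t : ℝ => lPoly c' D a₁ R r h d θ (1 + t * I) := by
  unfold lPoly
  refine continuous_finsetSum _ fun l hl => ?_
  have hl0 : (l : ℂ) ≠ 0 := by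
    have h0 : 0 < l := pos_of_mem_natI (Finset.mem_filter.1 hl).1
    exact_mod_cast h0.ne'
  exact continuous_const.mul (Continuous.const_cpow (by fun_prop) (Or.inl hl0))

/-- The prime polynomial is continuous along the line `s = 1 + it + β₃`. [folklore] -/
private theorem continuous_pPoly_line (c' : ℝ) (D r : ℕ) (θ : DirichletCharacter ℂ r) :
    Continuous fun t : ℝ => pPoly D r θ (1 + t * I + Skeleton.beta3 c' D) := by
  unfold pPoly
  refine continuous_finsetSum _ fun p hp => ?_
  have hp0 : (p : ℂ) ≠ 0 := by
    have h0 : p.Prime := (Finset.mem_filter.mp hp).2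
    exact_mod_cast h0.ne_zero
  exact continuous_const.mul (Continuous.const_cpow (by fun_prop) (Or.inl hp0))

/-- `√((R² + P)P³) ≤ RP^{3/2} + P²` for `R, P ≥ 0`. [folklore] -/
private theorem sqrt_main_le {R P : ℝ} (hR : 0 ≤ R) (hP : 0 ≤ P) :
    Real.sqrt ((R ^ 2 + P) * P ^ 3) ≤ R * P ^ (3 / 2 : ℝ) + P ^ 2 := by
  have hP32 : (P ^ (3 / 2 : ℝ)) ^ 2 = P ^ 3 := by
    rw [← Real.rpow_natCast _ 2, ← Real.rpow_mul hP,
      show (3 / 2 : ℝ) * ((2 : ℕ) : ℝ) = ((3 : ℕ) : ℝ) by norm_num, Real.rpow_natCast]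
  have h0 : 0 ≤ R * P ^ (3 / 2 : ℝ) + P ^ 2 := by positivity
  rw [Real.sqrt_le_left h0]
  have hx : 0 ≤ R * P ^ (3 / 2 : ℝ) * P ^ 2 := by positivity
  nlinarith [hP32, hx]

open scoped Classical in
/-- The Cauchy step with a WEIGHT: if `|𝔰*(R,r,h,d;θ)| ≤ C₁𝓛^{k₁}·(hR)·∫|lPoly||pPoly|dt/(1+t²)` for
the pairs `(r, θ)`, `R ≤ r < 2R`, in the ranges of (7.15), then the two large-sieve bounds §7.u039–u040
give, by Cauchy's inequality in `(r, θ)` inside the `t`-integral, the first bound of §7.u041: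
`R^{−3/2} Σ_{R≤r<2R} Σ*_θ |𝔰*| ≤ C·τ₅(d)h𝓛^{k₁+k₂}(R^{1/2}P^{3/2} + R^{−1/2}P²)`
(`C = max C₁ 0 · |C₂| · √(max C₃ 0) · π`). Both the printed (weightless) §7.u038 and the Mellin step
with its factor `hr ≤ 2hR` feed this. [cite: Zhang2022LandauSiegel, §7 p.39, tex L2055] -/
private theorem first_bound_of_weighted (c' : ℝ) {B : ℝ} {k₁ : ℕ} {C₁ : ℝ}
    (h38w : Skeleton.ForAllLarge fun D _ χ => Skeleton.AssumptionA D χ →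
      ∀ a₁ : ℕ → ℂ, Skeleton.Adm72 D B a₁ → ∀ (d h : ℕ) (R : ℝ), 0 < d → 0 < h →
        InRange735 D d h R → ∀ r ∈ dyadic R, ∀ θ : DirichletCharacter ℂ r,
          ‖frakSstar c' D a₁ R r h d θ‖ ≤
            C₁ * Skeleton.ell D ^ k₁ * ((h : ℝ) * R) *
              ∫ t : ℝ, ‖lPoly c' D a₁ R r h d θ (1 + t * I)‖ *
                ‖pPoly D r θ (1 + t * I + Skeleton.beta3 c' D)‖ / (1 + t ^ 2))
    (h39 : Step7u039 c') (h40 : Step7u040) :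
    ∃ k : ℕ, ∃ C : ℝ, Skeleton.ForAllLarge fun D _ χ => Skeleton.AssumptionA D χ →
      ∀ a₁ : ℕ → ℂ, Skeleton.Adm72 D B a₁ → ∀ (d h : ℕ) (R : ℝ), 0 < d → 0 < h →
        InRange735 D d h R →
          R ^ (-(3 / 2 : ℝ)) * ∑ r ∈ dyadic R, ∑ θ : DirichletCharacter ℂ r,
              (if θ.IsPrimitive then ‖frakSstar c' D a₁ R r h d θ‖ else 0) ≤
            C * MeanSquareMajorant.tau 5 d * (h : ℝ) * Skeleton.ell D ^ k *
              (R ^ (1 / 2 : ℝ) * Skeleton.bigP D ^ (3 / 2 : ℝ) +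
                R ^ (-(1 / 2 : ℝ)) * Skeleton.bigP D ^ 2) := by
  obtain ⟨D₁, h38⟩ := h38w
  obtain ⟨k₂, C₂, D₂, h39⟩ := h39 B
  obtain ⟨C₃, D₃, h40⟩ := h40
  refine ⟨k₁ + k₂, max C₁ 0 * |C₂| * Real.sqrt (max C₃ 0) * Real.pi, max (max D₁ D₂) (max D₃ 3),
    fun D _ χ hD hq hp hA a₁ ha d h R hd hh hR => ?_⟩
  have hD₁ : D₁ ≤ D := le_trans (le_trans (le_max_left _ _) (le_max_left _ _)) hD
  have hD₂ : D₂ ≤ D := le_trans (le_trans (le_max_right _ _) (le_max_left _ _)) hD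
  have hD₃ : D₃ ≤ D := le_trans (le_trans (le_max_left _ _) (le_max_right _ _)) hD
  have hD3 : 3 ≤ D := le_trans (le_trans (le_max_right _ _) (le_max_right _ _)) hD
  have hL1 : 1 ≤ Skeleton.ell D := one_le_ell hD3
  have hD0 : (0 : ℝ) < D := by exact_mod_cast (show 0 < D by omega)
  obtain ⟨hdh, hDR, hRlt⟩ := id hR
  have hR0 : 0 < R := hD0.trans_le hDR
  have hR1 : 1 ≤ R := le_trans (by exact_mod_cast (show 1 ≤ D by omega)) hDR
  have hP : 0 < Skeleton.bigP D := Real.exp_pos _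
  have ht0 : 0 < Skeleton.t0 D := by unfold Skeleton.t0; positivity
  have hh1 : (1 : ℝ) ≤ h := by exact_mod_cast hh
  have hτ : 0 ≤ MeanSquareMajorant.tau 5 d := MeanSquareMajorant.tau_nonneg _ _
  have H38 := h38 D χ hD₁ hq hp hA a₁ ha d h R hd hh hR
  have H39 := h39 D χ hD₂ hq hp hA a₁ ha d h R hd hh hR
  have H40 := h40 D χ hD₃ hq hp hA R hR1
  -- the constant `C₂` is positive: the displayed quotient of §7.u039 is positive and `≤ C₂`
  have hC₂ : 0 < C₂ := by
    have hQ : 0 < (R ^ 2 + Skeleton.bigP D * R * h * Skeleton.t0 D) /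
        (Skeleton.bigP D * R * h * Skeleton.t0 D) := by positivity
    exact hQ.trans_le (H39 0).2
  -- notation
  set L := Skeleton.ell D with hLdef
  set P := Skeleton.bigP D with hPdef
  set τ := MeanSquareMajorant.tau 5 d with hτdef
  set T : Finset (Σ r : ℕ, DirichletCharacter ℂ r) := (dyadic R).sigma fun r =>
      (Finset.univ : Finset (DirichletCharacter ℂ r)).filter fun θ => θ.IsPrimitive with hTdef
  set lN : (Σ r : ℕ, DirichletCharacter ℂ r) → ℝ → ℝ :=
    fun x t => ‖lPoly c' D a₁ R x.1 h d x.2 (1 + t * I)‖ with hlNdef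
  set pN : (Σ r : ℕ, DirichletCharacter ℂ r) → ℝ → ℝ :=
    fun x t => ‖pPoly D x.1 x.2 (1 + t * I + Skeleton.beta3 c' D)‖ with hpNdef
  set ML : ℝ := C₂ * τ * L ^ k₂ with hMLdef
  set MP : ℝ := Real.sqrt (C₃ * (R ^ 2 + P) * P ^ 3) with hMPdef
  have hML0 : 0 ≤ ML := by positivity
  have hMP0 : 0 ≤ MP := Real.sqrt_nonneg _
  -- (1) the `l`-mean square is at most `ML²`
  have hSL : ∀ t : ℝ, ∑ x ∈ T, lN x t ^ 2 ≤ ML ^ 2 := by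
    intro t
    have h1 := (H39 t).1
    have h2 := (H39 t).2
    rw [sum_prim_eq_sum_sigma] at h1
    calc ∑ x ∈ T, lN x t ^ 2 ≤ C₂ * τ ^ 2 * L ^ k₂ *
          ((R ^ 2 + P * R * h * Skeleton.t0 D) / (P * R * h * Skeleton.t0 D)) := h1
      _ ≤ C₂ * τ ^ 2 * L ^ k₂ * C₂ := by gcongr
      _ ≤ C₂ * τ ^ 2 * L ^ k₂ * C₂ * L ^ k₂ := by
          have : 1 ≤ L ^ k₂ := one_le_pow₀ hL1
          nlinarith [mul_nonneg (mul_nonneg (mul_nonneg hC₂.le (sq_nonneg τ)) (pow_nonneg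
            (zero_le_one.trans hL1) k₂)) hC₂.le]
      _ = ML ^ 2 := by rw [hMLdef]; ring
  -- (2) the `p`-mean square is at most `MP²`
  have hSP : ∀ t : ℝ, ∑ x ∈ T, pN x t ^ 2 ≤ MP ^ 2 := by
    intro t
    have hre : (1 + t * I + Skeleton.beta3 c' D).re = 1 := by
      simp [Complex.add_re, beta3_re_eq_zero]
    have h1 := H40 _ hre
    rw [sum_prim_eq_sum_sigma] at h1
    have h0 : 0 ≤ C₃ * (R ^ 2 + P) * P ^ 3 :=
      le_trans (Finset.sum_nonneg fun x _ => sq_nonneg (pN x t)) h1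
    rw [hMPdef, Real.sq_sqrt h0]
    exact h1
  -- (3) pointwise bounds for single terms
  have hlN : ∀ x ∈ T, ∀ t : ℝ, lN x t ≤ ML := by
    intro x hx t
    have h1 : lN x t ^ 2 ≤ ML ^ 2 :=
      le_trans (Finset.single_le_sum (fun y _ => sq_nonneg (lN y t)) hx) (hSL t)
    exact le_trans (le_abs_self _) (abs_le_of_sq_le_sq h1 hML0)
  have hpN : ∀ x ∈ T, ∀ t : ℝ, pN x t ≤ MP := by
    intro x hx t
    have h1 : pN x t ^ 2 ≤ MP ^ 2 :=
      le_trans (Finset.single_le_sum (fun y _ => sq_nonneg (pN y t)) hx) (hSP t)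
    exact le_trans (le_abs_self _) (abs_le_of_sq_le_sq h1 hMP0)
  -- (4) Cauchy's inequality in `(r, θ)`, pointwise in `t`
  have hCS : ∀ t : ℝ, ∑ x ∈ T, lN x t * pN x t ≤ ML * MP := by
    intro t
    have h1 : (∑ x ∈ T, lN x t * pN x t) ^ 2 ≤ (ML * MP) ^ 2 := by
      calc (∑ x ∈ T, lN x t * pN x t) ^ 2 ≤ (∑ x ∈ T, lN x t ^ 2) * ∑ x ∈ T, pN x t ^ 2 :=
            Finset.sum_mul_sq_le_sq_mul_sq _ _ _
        _ ≤ ML ^ 2 * MP ^ 2 :=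
            mul_le_mul (hSL t) (hSP t) (Finset.sum_nonneg fun x _ => sq_nonneg _) (sq_nonneg _)
        _ = (ML * MP) ^ 2 := by ring
    exact le_trans (le_abs_self _) (abs_le_of_sq_le_sq h1 (mul_nonneg hML0 hMP0))
  -- (5) integrability of each integrand (continuous, dominated by `ML·MP/(1+t²)`)
  have hInt : ∀ x ∈ T, Integrable fun t : ℝ => lN x t * pN x t / (1 + t ^ 2) := by
    intro x hx
    refine Integrable.mono' (integrable_inv_one_add_sq.const_mul (ML * MP)) ?_ ?_
    · have hc : Continuous fun t : ℝ => lN x t * pN x t / (1 + t ^ 2) :=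
        (((continuous_lPoly_line c' D a₁ R x.1 h d x.2).norm).mul
          ((continuous_pPoly_line c' D x.1 x.2).norm)).div (by fun_prop) fun t => by positivity
      exact hc.aestronglyMeasurable
    · refine Filter.Eventually.of_forall fun t => ?_
      have h0 : 0 ≤ lN x t * pN x t / (1 + t ^ 2) := by positivity
      rw [Real.norm_of_nonneg h0, div_eq_mul_inv]
      have := hlN x hx t
      have := hpN x hx t
      have : 0 ≤ pN x t := norm_nonneg _
      gcongr
  -- (6) the main chain
  have hstep : ∑ r ∈ dyadic R, ∑ θ : DirichletCharacter ℂ r,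
      (if θ.IsPrimitive then ‖frakSstar c' D a₁ R r h d θ‖ else 0) ≤
        max C₁ 0 * L ^ k₁ * ((h : ℝ) * R) * (ML * MP * Real.pi) := by
    rw [sum_prim_eq_sum_sigma]
    calc ∑ x ∈ T, ‖frakSstar c' D a₁ R x.1 h d x.2‖
        ≤ ∑ x ∈ T, max C₁ 0 * L ^ k₁ * ((h : ℝ) * R) *
            ∫ t : ℝ, lN x t * pN x t / (1 + t ^ 2) := by
          refine Finset.sum_le_sum fun x hx => ?_
          have hr : x.1 ∈ dyadic R := (Finset.mem_sigma.1 hx).1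
          have hI0 : 0 ≤ ∫ t : ℝ, lN x t * pN x t / (1 + t ^ 2) :=
            integral_nonneg fun t => by positivity
          calc ‖frakSstar c' D a₁ R x.1 h d x.2‖
              ≤ C₁ * L ^ k₁ * ((h : ℝ) * R) * ∫ t : ℝ, lN x t * pN x t / (1 + t ^ 2) :=
                H38 x.1 hr x.2
            _ ≤ max C₁ 0 * L ^ k₁ * ((h : ℝ) * R) * ∫ t : ℝ, lN x t * pN x t / (1 + t ^ 2) := by
                gcongr; exact le_max_left _ _
      _ = max C₁ 0 * L ^ k₁ * ((h : ℝ) * R) *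
            ∫ t : ℝ, ∑ x ∈ T, lN x t * pN x t / (1 + t ^ 2) := by
          rw [← Finset.mul_sum, integral_finsetSum _ hInt]
      _ ≤ max C₁ 0 * L ^ k₁ * ((h : ℝ) * R) * ∫ t : ℝ, ML * MP * (1 + t ^ 2)⁻¹ := by
          refine mul_le_mul_of_nonneg_left ?_ (by positivity)
          refine integral_mono_of_nonneg (Filter.Eventually.of_forall fun t =>
            Finset.sum_nonneg fun x _ => by positivity)
            (integrable_inv_one_add_sq.const_mul (ML * MP))
            (Filter.Eventually.of_forall fun t => ?_)
          have h1t : 0 < 1 + t ^ 2 := by positivity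
          calc ∑ x ∈ T, lN x t * pN x t / (1 + t ^ 2)
              = (∑ x ∈ T, lN x t * pN x t) / (1 + t ^ 2) := by rw [Finset.sum_div]
            _ ≤ ML * MP / (1 + t ^ 2) := by gcongr; exact hCS t
            _ = ML * MP * (1 + t ^ 2)⁻¹ := div_eq_mul_inv _ _
      _ = max C₁ 0 * L ^ k₁ * ((h : ℝ) * R) * (ML * MP * Real.pi) := by
          rw [integral_const_mul, integral_univ_inv_one_add_sq]
  -- (7) the shape of the bound
  have hMP : MP ≤ Real.sqrt (max C₃ 0) * (R * P ^ (3 / 2 : ℝ) + P ^ 2) := by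
    have hX : 0 ≤ (R ^ 2 + P) * P ^ 3 := by positivity
    calc MP ≤ Real.sqrt (max C₃ 0 * ((R ^ 2 + P) * P ^ 3)) := by
          rw [hMPdef]; apply Real.sqrt_le_sqrt
          rw [mul_assoc]; exact mul_le_mul_of_nonneg_right (le_max_left _ _) hX
      _ = Real.sqrt (max C₃ 0) * Real.sqrt ((R ^ 2 + P) * P ^ 3) :=
          Real.sqrt_mul (le_max_right _ _) _
      _ ≤ Real.sqrt (max C₃ 0) * (R * P ^ (3 / 2 : ℝ) + P ^ 2) := by
          gcongr; exact sqrt_main_le hR0.le hP.le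
  have hRR : R ^ (-(3 / 2 : ℝ)) * R * (R * P ^ (3 / 2 : ℝ) + P ^ 2) =
      R ^ (1 / 2 : ℝ) * P ^ (3 / 2 : ℝ) + R ^ (-(1 / 2 : ℝ)) * P ^ 2 := by
    have h1 : R ^ (-(3 / 2 : ℝ)) * R = R ^ (-(1 / 2 : ℝ)) := by
      rw [← Real.rpow_add_one hR0.ne']; norm_num
    have h2 : R ^ (-(1 / 2 : ℝ)) * R = R ^ (1 / 2 : ℝ) := by
      rw [← Real.rpow_add_one hR0.ne']; norm_num
    calc R ^ (-(3 / 2 : ℝ)) * R * (R * P ^ (3 / 2 : ℝ) + P ^ 2)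
        = (R ^ (-(3 / 2 : ℝ)) * R * R) * P ^ (3 / 2 : ℝ) + (R ^ (-(3 / 2 : ℝ)) * R) * P ^ 2 := by
          ring
      _ = R ^ (1 / 2 : ℝ) * P ^ (3 / 2 : ℝ) + R ^ (-(1 / 2 : ℝ)) * P ^ 2 := by rw [h1, h2]
  -- (8) assemble
  have hR32 : 0 ≤ R ^ (-(3 / 2 : ℝ)) := Real.rpow_nonneg hR0.le _
  calc R ^ (-(3 / 2 : ℝ)) * ∑ r ∈ dyadic R, ∑ θ : DirichletCharacter ℂ r,
        (if θ.IsPrimitive then ‖frakSstar c' D a₁ R r h d θ‖ else 0)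
      ≤ R ^ (-(3 / 2 : ℝ)) * (max C₁ 0 * L ^ k₁ * ((h : ℝ) * R) * (ML * MP * Real.pi)) :=
        mul_le_mul_of_nonneg_left hstep hR32
    _ = (max C₁ 0 * C₂ * Real.pi) * τ * (h : ℝ) * L ^ (k₁ + k₂) *
          (R ^ (-(3 / 2 : ℝ)) * R * MP) := by
        rw [hMLdef, pow_add]; ring
    _ ≤ (max C₁ 0 * |C₂| * Real.pi) * τ * (h : ℝ) * L ^ (k₁ + k₂) *
          (R ^ (-(3 / 2 : ℝ)) * R * (Real.sqrt (max C₃ 0) * (R * P ^ (3 / 2 : ℝ) + P ^ 2))) := by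
        gcongr
        · exact le_abs_self _
    _ = (max C₁ 0 * |C₂| * Real.sqrt (max C₃ 0) * Real.pi) * τ * (h : ℝ) * L ^ (k₁ + k₂) *
          (R ^ (-(3 / 2 : ℝ)) * R * (R * P ^ (3 / 2 : ℝ) + P ^ 2)) := by ring
    _ = (max C₁ 0 * |C₂| * Real.sqrt (max C₃ 0) * Real.pi) * τ * (h : ℝ) * L ^ (k₁ + k₂) *
          (R ^ (1 / 2 : ℝ) * P ^ (3 / 2 : ℝ) + R ^ (-(1 / 2 : ℝ)) * P ^ 2) := by rw [hRR]

open scoped Classical in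
/-- `Z22:§7.u041`, first bound, as an EDGE: the Mellin bound §7.u038 (as printed, without weight) and
the two large-sieve bounds §7.u039–§7.u040 imply, by Cauchy's inequality in `(r, θ)` inside the
`t`-integral, `R^{−3/2} Σ_{R≤r<2R} Σ*_θ |𝔰*(R,r,h,d;θ)| ≤ C·τ₅(d)h𝓛^{k₁+k₂}(R^{1/2}P^{3/2} + R^{−1/2}P²)`
in the ranges of (7.15). [cite: Zhang2022LandauSiegel, §7 p.39, tex L2055] -/
theorem step7u041_left_of (c' : ℝ) (h38 : Step7u038 c') (h39 : Step7u039 c') (h40 : Step7u040)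
    (B : ℝ) : ∃ k : ℕ, ∃ C : ℝ, Skeleton.ForAllLarge fun D _ χ => Skeleton.AssumptionA D χ →
      ∀ a₁ : ℕ → ℂ, Skeleton.Adm72 D B a₁ → ∀ (d h : ℕ) (R : ℝ), 0 < d → 0 < h →
        InRange735 D d h R →
          R ^ (-(3 / 2 : ℝ)) * ∑ r ∈ dyadic R, ∑ θ : DirichletCharacter ℂ r,
              (if θ.IsPrimitive then ‖frakSstar c' D a₁ R r h d θ‖ else 0) ≤
            C * MeanSquareMajorant.tau 5 d * (h : ℝ) * Skeleton.ell D ^ k *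
              (R ^ (1 / 2 : ℝ) * Skeleton.bigP D ^ (3 / 2 : ℝ) +
                R ^ (-(1 / 2 : ℝ)) * Skeleton.bigP D ^ 2) := by
  obtain ⟨k₁, C₁, D₁, h38⟩ := h38 B
  refine first_bound_of_weighted c' (k₁ := k₁) (C₁ := max C₁ 0) ⟨max D₁ 1, ?_⟩ h39 h40
  intro D _ χ hD hq hp hA a₁ ha d h R hd hh hR r hr θ
  have H := h38 D χ (le_trans (le_max_left _ _) hD) hq hp hA a₁ ha d h R hd hh hR r hr θ
  have hD1 : (1 : ℝ) ≤ D := by exact_mod_cast (show 1 ≤ D from le_trans (le_max_right _ _) hD)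
  have hR1 : 1 ≤ R := le_trans hD1 hR.2.1
  have hh1 : (1 : ℝ) ≤ h := by exact_mod_cast hh
  have hI0 : 0 ≤ ∫ t : ℝ, ‖lPoly c' D a₁ R r h d θ (1 + t * I)‖ *
      ‖pPoly D r θ (1 + t * I + Skeleton.beta3 c' D)‖ / (1 + t ^ 2) :=
    integral_nonneg fun t => by positivity
  have hL0 : 0 ≤ Skeleton.ell D ^ k₁ :=
    pow_nonneg (by rw [Skeleton.ell]; exact Real.log_natCast_nonneg D) _
  calc ‖frakSstar c' D a₁ R r h d θ‖
      ≤ C₁ * Skeleton.ell D ^ k₁ * ∫ t : ℝ, ‖lPoly c' D a₁ R r h d θ (1 + t * I)‖ *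
          ‖pPoly D r θ (1 + t * I + Skeleton.beta3 c' D)‖ / (1 + t ^ 2) := H
    _ ≤ max C₁ 0 * Skeleton.ell D ^ k₁ * ∫ t : ℝ, ‖lPoly c' D a₁ R r h d θ (1 + t * I)‖ *
          ‖pPoly D r θ (1 + t * I + Skeleton.beta3 c' D)‖ / (1 + t ^ 2) :=
        mul_le_mul_of_nonneg_right (mul_le_mul_of_nonneg_right (le_max_left _ _) hL0) hI0
    _ = max C₁ 0 * Skeleton.ell D ^ k₁ * (1 * 1) *
          ∫ t : ℝ, ‖lPoly c' D a₁ R r h d θ (1 + t * I)‖ *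
            ‖pPoly D r θ (1 + t * I + Skeleton.beta3 c' D)‖ / (1 + t ^ 2) := by ring
    _ ≤ max C₁ 0 * Skeleton.ell D ^ k₁ * ((h : ℝ) * R) *
          ∫ t : ℝ, ‖lPoly c' D a₁ R r h d θ (1 + t * I)‖ *
            ‖pPoly D r θ (1 + t * I + Skeleton.beta3 c' D)‖ / (1 + t ^ 2) := by
        gcongr
/-! ### The Mellin step `§7.u038` with its factor `hr`; `§7.u041` holds; (7.15) from `Step7bTruncI` -/

/-- `t ↦ x^{−(1+it)}` (`x > 0`) is continuous. [folklore] -/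
private theorem continuous_cpow_neg_line {x : ℝ} (hx : 0 < x) :
    Continuous fun t : ℝ => (x : ℂ) ^ (-(1 + t * I)) := by
  have hx0 : (x : ℂ) ≠ 0 := ofReal_ne_zero.mpr hx.ne'
  exact Continuous.const_cpow (by fun_prop) (Or.inl hx0)

/-- `‖x^{−(1+it)}‖ = x⁻¹` for `x > 0`. [folklore] -/
private theorem norm_cpow_neg_line {x : ℝ} (hx : 0 < x) (t : ℝ) :
    ‖(x : ℂ) ^ (-(1 + t * I))‖ = x⁻¹ := by
  rw [Complex.norm_cpow_eq_rpow_re_of_pos hx]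
  simp [Real.rpow_neg_one]

/-- The Mellin kernel splits: `(l/(phr))^{−s} = (hr)^{s}·l^{−s}·p^{s}` for positive `l, p, h, r`.
[folklore] -/
private theorem kernel_split {l p h r : ℕ} (hl : 0 < l) (hp : 0 < p) (hh : 0 < h) (hr : 0 < r)
    (s : ℂ) :
    ((((l : ℝ) / ((p : ℝ) * h * r)) : ℝ) : ℂ) ^ (-s) =
      ((h * r : ℕ) : ℂ) ^ s * (l : ℂ) ^ (-s) * (p : ℂ) ^ s := by
  have hl' : (0 : ℝ) < l := by exact_mod_cast hl
  have hp' : (0 : ℝ) < p := by exact_mod_cast hp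
  have hhr' : (0 : ℝ) < ((h * r : ℕ) : ℝ) := by exact_mod_cast Nat.mul_pos hh hr
  have e : (((l : ℝ) / ((p : ℝ) * h * r)) : ℝ) = (l : ℝ) * (((p : ℝ) * ((h * r : ℕ) : ℝ))⁻¹) := by
    push_cast; rw [div_eq_mul_inv]; ring
  rw [e, Complex.ofReal_mul, Complex.mul_cpow_ofReal_nonneg hl'.le (by positivity),
    Complex.ofReal_inv, Complex.inv_cpow _ _ (by
      rw [Complex.arg_ofReal_of_nonneg (by positivity)]; exact Real.pi_ne_zero.symm),
    Complex.ofReal_mul, Complex.mul_cpow_ofReal_nonneg hp'.le hhr'.le]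
  simp only [Complex.cpow_neg, mul_inv, inv_inv]
  push_cast
  ring

/-- The trivial bound `|Σ_{p∼P} θ̄(p)p^{s}| ≤ 𝔓` on `Re s = 1`. [folklore] -/
private theorem norm_pPoly_le (D r : ℕ) (θ : DirichletCharacter ℂ r) {s : ℂ} (hs : s.re = 1) :
    ‖pPoly D r θ s‖ ≤ frakP D := by
  unfold pPoly
  rw [Skeleton.frakP_eq_sum_primeWindow]
  refine (norm_sum_le _ _).trans (Finset.sum_le_sum fun p hp => ?_)
  have hp0 : 0 < p := (Finset.mem_filter.mp hp).2.pos
  rw [norm_mul, Complex.norm_natCast_cpow_of_pos hp0, hs, Real.rpow_one]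
  calc ‖θ⁻¹ (p : ZMod r)‖ * (p : ℝ) ≤ 1 * p := by
        gcongr; exact DirichletCharacter.norm_le_one _ _
    _ = p := one_mul _

/-- The trivial bound `|Σ_l (κ∗a₁)(dl)θ(l)l^{−1−it}| ≤ Σ_l |(κ∗a₁)(dl)|`. [folklore] -/
private theorem norm_lPoly_le (c' : ℝ) (D : ℕ) (a₁ : ℕ → ℂ) (R : ℝ) (r h d : ℕ)
    (θ : DirichletCharacter ℂ r) (t : ℝ) :
    ‖lPoly c' D a₁ R r h d θ (1 + t * I)‖ ≤
      ∑ l ∈ (natI D (R * h)).filter (fun l => Nat.Coprime l h),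
        ‖MeanSquareMajorant.conv (Skeleton.kappaZ c' D) a₁ (d * l)‖ := by
  unfold lPoly
  refine (norm_sum_le _ _).trans (Finset.sum_le_sum fun l hl => ?_)
  have hl0 : 0 < l := pos_of_mem_natI (Finset.mem_filter.1 hl).1
  have hl1 : (1 : ℝ) ≤ l := by exact_mod_cast hl0
  rw [norm_mul, norm_mul, Complex.norm_natCast_cpow_of_pos hl0]
  have hre : (-(1 + (t : ℂ) * I)).re = -1 := by simp
  rw [hre, Real.rpow_neg_one]
  calc ‖MeanSquareMajorant.conv (Skeleton.kappaZ c' D) a₁ (d * l)‖ * ‖θ (l : ZMod r)‖ * (l : ℝ)⁻¹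
      ≤ ‖MeanSquareMajorant.conv (Skeleton.kappaZ c' D) a₁ (d * l)‖ * 1 * 1 := by
        gcongr
        · exact DirichletCharacter.norm_le_one _ _
        · exact inv_le_one_of_one_le₀ hl1
    _ = _ := by ring

/-- `Z22:§7.u038`, the Mellin step WITH ITS FACTOR `hr`: for all large `D`, every `a₁`, `R`,
`r, h ≥ 1`, `d`, and every character `θ (mod r)`,
`|𝔰*(R,r,h,d;θ)| ≤ C·𝓛⁵¹⁹⁰·hr·∫ |Σ_l (κ∗a₁)(dl)θ(l)l^{−1−it}|·|Σ_{p∼P} θ̄(p)p^{1+it+β₃}| dt/(1+t²)`,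
with `C = K₅₄/(2π)`, `K₅₄` the constant of Lemma 5.4 (i) on `σ = 1` (`Skeleton.norm_deltaW_line_le`).
Exact route: Mellin inversion `Δ(x) = (1/2π)∫ x^{−(1+it)}δ(1+it)dt` (`Skeleton.DeltaW_eq_mellinInv`)
inserted for each `(l, p)`, the finite sums taken inside the integral, the kernel
`(l/(phr))^{−s} = (hr)^{s}l^{−s}p^{s}` factoring the integrand as `δ(1+it)(hr)^{1+it}·lPoly·pPoly`, and
`|δ(1+it)| ≤ K₅₄𝓛⁵¹⁹⁰/(1+t²)`. (The printed display (tex L2043) omits the factor `hr`; the next display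
§7.u041, with its factor `h`, is what this version yields by Cauchy's inequality.)
[cite: Zhang2022LandauSiegel, §7 p.38, tex L2043] -/
theorem step7u038_hr (c' : ℝ) : ∃ C : ℝ, Skeleton.ForAllLarge fun D _ _ =>
    ∀ (a₁ : ℕ → ℂ) (R : ℝ) (r h d : ℕ) (θ : DirichletCharacter ℂ r), 0 < r → 0 < h →
      ‖frakSstar c' D a₁ R r h d θ‖ ≤
        C * Skeleton.ell D ^ 5190 * ((h * r : ℕ) : ℝ) *
          ∫ t : ℝ, ‖lPoly c' D a₁ R r h d θ (1 + t * I)‖ *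
            ‖pPoly D r θ (1 + t * I + Skeleton.beta3 c' D)‖ / (1 + t ^ 2) := by
  obtain ⟨K, hK⟩ : ∃ K : ℝ, ∀ D : ℕ, 3 ≤ D → ∀ t : ℝ,
      ‖Skeleton.deltaW D (1 + t * I)‖ ≤ K * Skeleton.ell D ^ 5190 * (1 + t ^ 2)⁻¹ :=
    ⟨_, fun D hD t => Skeleton.norm_deltaW_line_le hD t⟩
  obtain ⟨D₀, hall⟩ := Skeleton.DeltaW_eq_mellinInv.and Skeleton.integrable_deltaW_line
  refine ⟨1 / (2 * π) * K, max D₀ 3, fun D _ χ hD hq hp a₁ R r h d θ hr hh => ?_⟩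
  have hD3 : 3 ≤ D := le_trans (le_max_right _ _) hD
  obtain ⟨hinv, hint⟩ := hall D χ (le_trans (le_max_left _ _) hD) hq hp
  have hhr : 0 < h * r := Nat.mul_pos hh hr
  -- notation
  set Lset := (natI D (R * h)).filter (fun l => Nat.Coprime l h) with hLset
  set W := Skeleton.primeWindow D with hW
  have hl0 : ∀ l ∈ Lset, 0 < l := fun l hl => pos_of_mem_natI (Finset.mem_filter.1 hl).1
  have hp0 : ∀ p ∈ W, 0 < p := fun p hp => (Finset.mem_filter.mp hp).2.pos
  -- the integrands after Mellin inversion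
  set G : ℕ → ℕ → ℝ → ℂ := fun l p t =>
    MeanSquareMajorant.conv (Skeleton.kappaZ c' D) a₁ (d * l) * θ (l : ZMod r) *
      (θ⁻¹ (p : ZMod r) * (p : ℂ) ^ Skeleton.beta3 c' D *
        (((((l : ℝ) / ((p : ℝ) * h * r)) : ℝ) : ℂ) ^ (-(1 + t * I)) *
          Skeleton.deltaW D (1 + t * I))) with hG
  have hGint : ∀ l ∈ Lset, ∀ p ∈ W, Integrable (G l p) := by
    intro l hl p hp
    have hx : 0 < (l : ℝ) / ((p : ℝ) * h * r) := by
      have := hl0 l hl; have := hp0 p hp; positivity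
    exact ((hint.bdd_mul (continuous_cpow_neg_line hx).aestronglyMeasurable
      (Filter.Eventually.of_forall fun t => (norm_cpow_neg_line hx t).le)).const_mul _).const_mul _
  -- Step 1: `𝔰* = (1/2π) ∫ Σ_l Σ_p G`
  have hrepr : frakSstar c' D a₁ R r h d θ =
      ((1 / (2 * π) : ℝ) : ℂ) * ∫ t : ℝ, ∑ l ∈ Lset, ∑ p ∈ W, G l p t := by
    rw [integral_finsetSum _ fun l hl => integrable_finsetSum _ fun p hp => hGint l hl p hp,
      Finset.mul_sum]
    unfold frakSstar
    refine Finset.sum_congr rfl fun l hl => ?_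
    rw [integral_finsetSum _ fun p hp => hGint l hl p hp, Finset.mul_sum, Finset.mul_sum]
    refine Finset.sum_congr rfl fun p hp => ?_
    have hx : 0 < (l : ℝ) / ((p : ℝ) * h * r) := by
      have := hl0 l hl; have := hp0 p hp; positivity
    rw [hinv _ hx, hG]
    simp only []
    rw [integral_const_mul, integral_const_mul, Complex.real_smul]
    simp_rw [smul_eq_mul]
    ring
  -- Step 2: the integrand factors as `δ(1+it)·(hr)^{1+it}·lPoly(1+it)·pPoly(1+it+β₃)`
  have hpt : ∀ t : ℝ, ∑ l ∈ Lset, ∑ p ∈ W, G l p t =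
      Skeleton.deltaW D (1 + t * I) * ((h * r : ℕ) : ℂ) ^ (1 + (t : ℂ) * I) *
        lPoly c' D a₁ R r h d θ (1 + t * I) * pPoly D r θ (1 + t * I + Skeleton.beta3 c' D) := by
    intro t
    have e : ∀ l ∈ Lset, ∀ p ∈ W, G l p t =
        Skeleton.deltaW D (1 + t * I) * ((h * r : ℕ) : ℂ) ^ (1 + (t : ℂ) * I) *
          ((MeanSquareMajorant.conv (Skeleton.kappaZ c' D) a₁ (d * l) * θ (l : ZMod r) *
              (l : ℂ) ^ (-(1 + (t : ℂ) * I))) *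
            (θ⁻¹ (p : ZMod r) * (p : ℂ) ^ (1 + (t : ℂ) * I + Skeleton.beta3 c' D))) := by
      intro l hl p hp
      have hpz : (p : ℂ) ≠ 0 := by exact_mod_cast (hp0 p hp).ne'
      simp only [hG]
      rw [kernel_split (hl0 l hl) (hp0 p hp) hh hr]
      conv_rhs => rw [Complex.cpow_add _ _ hpz]
      ring
    calc ∑ l ∈ Lset, ∑ p ∈ W, G l p t
        = ∑ l ∈ Lset, ∑ p ∈ W, Skeleton.deltaW D (1 + t * I) * ((h * r : ℕ) : ℂ) ^ (1 + (t : ℂ) * I) *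
            ((MeanSquareMajorant.conv (Skeleton.kappaZ c' D) a₁ (d * l) * θ (l : ZMod r) *
                (l : ℂ) ^ (-(1 + (t : ℂ) * I))) *
              (θ⁻¹ (p : ZMod r) * (p : ℂ) ^ (1 + (t : ℂ) * I + Skeleton.beta3 c' D))) :=
          Finset.sum_congr rfl fun l hl => Finset.sum_congr rfl fun p hp => e l hl p hp
      _ = Skeleton.deltaW D (1 + t * I) * ((h * r : ℕ) : ℂ) ^ (1 + (t : ℂ) * I) *
            ((∑ l ∈ Lset, MeanSquareMajorant.conv (Skeleton.kappaZ c' D) a₁ (d * l) *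
                θ (l : ZMod r) * (l : ℂ) ^ (-(1 + (t : ℂ) * I))) *
              ∑ p ∈ W, θ⁻¹ (p : ZMod r) * (p : ℂ) ^ (1 + (t : ℂ) * I + Skeleton.beta3 c' D)) := by
          rw [Finset.sum_mul_sum, Finset.mul_sum]
          simp_rw [Finset.mul_sum]
      _ = _ := by unfold lPoly pPoly; ring
  -- Step 3: norms
  have hnorm : ∀ t : ℝ, ‖∑ l ∈ Lset, ∑ p ∈ W, G l p t‖ =
      ‖Skeleton.deltaW D (1 + t * I)‖ * ((h * r : ℕ) : ℝ) *
        (‖lPoly c' D a₁ R r h d θ (1 + t * I)‖ *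
          ‖pPoly D r θ (1 + t * I + Skeleton.beta3 c' D)‖) := by
    intro t
    have hre : ((1 : ℂ) + (t : ℂ) * I).re = 1 := by simp
    rw [hpt t, norm_mul, norm_mul, norm_mul, Complex.norm_natCast_cpow_of_pos hhr, hre,
      Real.rpow_one]
    ring
  -- Step 4: the majorant `K𝓛⁵¹⁹⁰·hr·‖lPoly‖‖pPoly‖/(1+t²)` is integrable
  set Ml : ℝ := ∑ l ∈ Lset, ‖MeanSquareMajorant.conv (Skeleton.kappaZ c' D) a₁ (d * l)‖ with hMl
  have hMl0 : 0 ≤ Ml := Finset.sum_nonneg fun _ _ => norm_nonneg _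
  have hfP0 : 0 ≤ frakP D := by
    rw [Skeleton.frakP_eq_sum_primeWindow]; exact Finset.sum_nonneg fun _ _ => Nat.cast_nonneg _
  have hcore : Integrable fun t : ℝ => ‖lPoly c' D a₁ R r h d θ (1 + t * I)‖ *
      ‖pPoly D r θ (1 + t * I + Skeleton.beta3 c' D)‖ / (1 + t ^ 2) := by
    refine Integrable.mono' (integrable_inv_one_add_sq.const_mul (Ml * frakP D)) ?_ ?_
    · exact ((((continuous_lPoly_line c' D a₁ R r h d θ).norm).mul
        ((continuous_pPoly_line c' D r θ).norm)).div (by fun_prop)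
        fun t => by positivity).aestronglyMeasurable
    · refine Filter.Eventually.of_forall fun t => ?_
      have h0 : 0 ≤ ‖lPoly c' D a₁ R r h d θ (1 + t * I)‖ *
          ‖pPoly D r θ (1 + t * I + Skeleton.beta3 c' D)‖ / (1 + t ^ 2) := by positivity
      rw [Real.norm_of_nonneg h0, div_eq_mul_inv]
      have hre : (1 + t * I + Skeleton.beta3 c' D).re = 1 := by
        simp [Complex.add_re, beta3_re_eq_zero]
      have h1 := norm_lPoly_le c' D a₁ R r h d θ t
      have h2 := norm_pPoly_le D r θ hre
      have : 0 ≤ ‖pPoly D r θ (1 + t * I + Skeleton.beta3 c' D)‖ := norm_nonneg _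
      gcongr
  -- Step 5: assemble
  have h2π : 0 ≤ (1 / (2 * π) : ℝ) := by positivity
  have hLk : 0 ≤ K * Skeleton.ell D ^ 5190 := by
    have h := hK D hD3 0
    have h0 : (0 : ℝ) < (1 + (0 : ℝ) ^ 2)⁻¹ := by norm_num
    nlinarith [norm_nonneg (Skeleton.deltaW D (1 + (0 : ℝ) * I)), h, h0]
  calc ‖frakSstar c' D a₁ R r h d θ‖
      = (1 / (2 * π)) * ‖∫ t : ℝ, ∑ l ∈ Lset, ∑ p ∈ W, G l p t‖ := by
        rw [hrepr, norm_mul, Complex.norm_real, Real.norm_of_nonneg h2π]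
    _ ≤ (1 / (2 * π)) * ∫ t : ℝ, ‖∑ l ∈ Lset, ∑ p ∈ W, G l p t‖ :=
        mul_le_mul_of_nonneg_left (norm_integral_le_integral_norm _) h2π
    _ = (1 / (2 * π)) * ∫ t : ℝ, ‖Skeleton.deltaW D (1 + t * I)‖ * ((h * r : ℕ) : ℝ) *
          (‖lPoly c' D a₁ R r h d θ (1 + t * I)‖ *
            ‖pPoly D r θ (1 + t * I + Skeleton.beta3 c' D)‖) := by simp_rw [hnorm]
    _ ≤ (1 / (2 * π)) * ∫ t : ℝ, K * Skeleton.ell D ^ 5190 * ((h * r : ℕ) : ℝ) *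
          (‖lPoly c' D a₁ R r h d θ (1 + t * I)‖ *
            ‖pPoly D r θ (1 + t * I + Skeleton.beta3 c' D)‖ / (1 + t ^ 2)) := by
        refine mul_le_mul_of_nonneg_left ?_ h2π
        refine integral_mono_of_nonneg (Filter.Eventually.of_forall fun t => by positivity)
          (hcore.const_mul _) (Filter.Eventually.of_forall fun t => ?_)
        have h1 := hK D hD3 t
        have h0 : 0 ≤ ‖lPoly c' D a₁ R r h d θ (1 + t * I)‖ *
            ‖pPoly D r θ (1 + t * I + Skeleton.beta3 c' D)‖ := by positivity
        calc ‖Skeleton.deltaW D (1 + t * I)‖ * ((h * r : ℕ) : ℝ) *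
              (‖lPoly c' D a₁ R r h d θ (1 + t * I)‖ *
                ‖pPoly D r θ (1 + t * I + Skeleton.beta3 c' D)‖)
            ≤ K * Skeleton.ell D ^ 5190 * (1 + t ^ 2)⁻¹ * ((h * r : ℕ) : ℝ) *
              (‖lPoly c' D a₁ R r h d θ (1 + t * I)‖ *
                ‖pPoly D r θ (1 + t * I + Skeleton.beta3 c' D)‖) := by gcongr
          _ = _ := by simp only [div_eq_mul_inv]; ring
    _ = 1 / (2 * π) * K * Skeleton.ell D ^ 5190 * ((h * r : ℕ) : ℝ) *
          ∫ t : ℝ, ‖lPoly c' D a₁ R r h d θ (1 + t * I)‖ *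
            ‖pPoly D r θ (1 + t * I + Skeleton.beta3 c' D)‖ / (1 + t ^ 2) := by
        rw [integral_const_mul]; ring


open scoped Classical in
/-- **`Z22:§7.u041` holds**: both bounds of the Cauchy step, for every `c′` — the first from the
Mellin step with its factor `hr ≤ 2hR` (`step7u038_hr`) and the tree's large-sieve theorems
`step7u039_holds`, `step7u040_holds` through the weighted Cauchy core; the second is
`step7u041_right`. [cite: Zhang2022LandauSiegel, §7 p.39, tex L2055] -/
theorem step7u041_holds (c' : ℝ) : Step7u041 c' := by
  refine ⟨fun B => ?_, step7u041_right⟩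
  obtain ⟨C₁, D₁, h38⟩ := step7u038_hr c'
  refine first_bound_of_weighted c' (k₁ := 5190) (C₁ := 2 * max C₁ 0) ⟨max D₁ 1, ?_⟩
    (step7u039_holds c') step7u040_holds
  intro D _ χ hD hq hp _ a₁ _ d h R _ hh hR r hr θ
  have hD1 : (1 : ℝ) ≤ D := by exact_mod_cast (show 1 ≤ D from le_trans (le_max_right _ _) hD)
  have hrR : R ≤ (r : ℝ) ∧ (r : ℝ) < 2 * R := (Finset.mem_filter.1 hr).2
  have hr1 : (1 : ℝ) ≤ r := le_trans (le_trans hD1 hR.2.1) hrR.1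
  have hr0 : 0 < r := by exact_mod_cast (show (0 : ℝ) < r by linarith)
  have H := h38 D χ (le_trans (le_max_left _ _) hD) hq hp a₁ R r h d θ hr0 hh
  have hI0 : 0 ≤ ∫ t : ℝ, ‖lPoly c' D a₁ R r h d θ (1 + t * I)‖ *
      ‖pPoly D r θ (1 + t * I + Skeleton.beta3 c' D)‖ / (1 + t ^ 2) :=
    integral_nonneg fun t => by positivity
  have hL0 : 0 ≤ Skeleton.ell D ^ 5190 :=
    pow_nonneg (by rw [Skeleton.ell]; exact Real.log_natCast_nonneg D) _
  have hhr : ((h * r : ℕ) : ℝ) ≤ (h : ℝ) * (2 * R) := by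
    push_cast; exact mul_le_mul_of_nonneg_left hrR.2.le (Nat.cast_nonneg h)
  calc ‖frakSstar c' D a₁ R r h d θ‖
      ≤ C₁ * Skeleton.ell D ^ 5190 * ((h * r : ℕ) : ℝ) *
          ∫ t : ℝ, ‖lPoly c' D a₁ R r h d θ (1 + t * I)‖ *
            ‖pPoly D r θ (1 + t * I + Skeleton.beta3 c' D)‖ / (1 + t ^ 2) := H
    _ ≤ max C₁ 0 * Skeleton.ell D ^ 5190 * ((h : ℝ) * (2 * R)) *
          ∫ t : ℝ, ‖lPoly c' D a₁ R r h d θ (1 + t * I)‖ *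
            ‖pPoly D r θ (1 + t * I + Skeleton.beta3 c' D)‖ / (1 + t ^ 2) := by
        refine mul_le_mul_of_nonneg_right ?_ hI0
        exact mul_le_mul (mul_le_mul_of_nonneg_right (le_max_left _ _) hL0) hhr
          (Nat.cast_nonneg _) (by positivity)
    _ = 2 * max C₁ 0 * Skeleton.ell D ^ 5190 * ((h : ℝ) * R) *
          ∫ t : ℝ, ‖lPoly c' D a₁ R r h d θ (1 + t * I)‖ *
            ‖pPoly D r θ (1 + t * I + Skeleton.beta3 c' D)‖ / (1 + t ^ 2) := by ring

/-- **(7.15) from the `Δ`-localisation alone**: `Step7bTruncI c′ → Eq715 c′` — the Mellin step, the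
large sieve and the Cauchy step are theorems (`step7u041_holds`), and the closing bookkeeping is
`eq715_of_truncI_u041`. [cite: Zhang2022LandauSiegel, §7 pp.38–39, tex L2028–L2058] -/
theorem eq715_of_truncI (c' : ℝ) (hT : Step7bTruncI c') : Eq715 c' :=
  eq715_of_truncI_u041 c' hT (step7u041_holds c')

open scoped Classical in
/-- `Z22:§7.u041` from `§7.u038`–`§7.u040`: "It follows by Cauchy's inequality that
`R^{−3/2} Σ_{R≤r<2R} Σ*_θ |𝔰*(R,r,h,d;θ)| ≪ τ₅(d)h𝓛ᶜ(R^{1/2}P^{3/2} + R^{−1/2}P²) ≪ τ₅(d)hP²D^{−c}`"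
— the typed claim `Step7u041 c′` PROVED from the Mellin bound and the two large-sieve bounds (the
second bound unconditionally, `step7u041_right`). [cite: Zhang2022LandauSiegel, §7 p.39, tex L2055] -/
theorem step7u041_of (c' : ℝ) (h38 : Step7u038 c') (h39 : Step7u039 c') (h40 : Step7u040) :
    Step7u041 c' :=
  ⟨step7u041_left_of c' h38 h39 h40, step7u041_right⟩

/-- `Z22:§7.u041` holds as soon as the Mellin bound `§7.u038` does (the large-sieve inputs
`§7.u039`, `§7.u040` are theorems of the tree). [cite: Zhang2022LandauSiegel, §7 p.39, tex L2055] -/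
theorem step7u041_of_mellin (c' : ℝ) (h38 : Step7u038 c') : Step7u041 c' :=
  step7u041_of c' h38 (step7u039_holds c') step7u040_holds

/-- (7.15) reduced to the two analytic inputs of the block: the `Δ`-localisation `l ∈ 𝔌(Rh)`
(`Step7bTruncI`) and the Mellin bound (7.14)/§7.u038 (`Step7u038`) imply `Eq715 c′`, via the tree's
`ded715_holds`. [cite: Zhang2022LandauSiegel, §7 pp.38–39, tex L2028–L2058] -/
theorem eq715_of (c' : ℝ) (hT : Step7bTruncI c') (h38 : Step7u038 c') : Eq715 c' :=
  ded715_holds c' hT h38 (step7u039_holds c') step7u040_holds (step7u041_of_mellin c' h38)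

end Literature.NumberTheory.LFunctions.Zhang2022.Section7cStatements
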